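import Literature.MathematicalPhysics.QuantumFieldTheory.Balaban1983to89.B8Thm2SetupTorus
import Literature.MathematicalPhysics.QuantumFieldTheory.Balaban1983to89.B8Eq131Derivation
import Literature.MathematicalPhysics.QuantumFieldTheory.Balaban1983to89.B8Eq178Averages
import Literature.MathematicalPhysics.QuantumFieldTheory.Balaban1983to89.T3SectALandauChart
import HarnessLib

/-!
# Route `UnitScaleTilt`, crux K1 child «MinimiserStabilityRegPr» (stmt-QuantumFields-19200), registered stub `stub_prop7From14` (skeleton birth_v7
# cc37a178…; leaf V3 «Prop 7 from a background (14)») — [Balaban1985Variational] p. 281 «THE ABOVE MAPPING IS ONE-TO-ONE», PROVED FOR PRINT'S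
# PRESENTATION AT THE SETUP-TORUS ∕ T³ CARRIER: the axial gauge (1.19) `Ax_k(𝔅_k, U₀)` and the averaged restriction (1.29) «(R̄₀uʲ)(y) = 1» of
# [Balaban1985RegularSpaces] (the letters `B8Thm2SetupTorus.InAxT` ∕ `Restr129T` of [Balaban1985RegularSpaces] Thm 2 at the Setup objects) DETERMINE
# THE CHART'S GAUGE TRANSFORMATION: `u = u′`

Cell `ym3-torus` ∕ fleet seat `ym-ust-19200-p1` (gen 8; HUMAN RULING D-0037, YM ladder rung R3; director-ym 2026-08-27 20:03Z (ii) «[B7] (78)–(80)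
averaged gauge transformations at the T³ carrier + the one-to-one chart-map skeleton»).  WHY.  The corrected knit
`Summit…Prop7ChartInjectivity.prop7From14At_of_props_inj` (this seat, sibling file) closes the leaf V3 from Props 2, 5, 6 at a presentation `S` and two
laws, the second being PRINT'S INJECTIVITY LAW: two `S.Restricted` gauge transformations `u, u′` whose images `(U₁U₀)^u`, `(U₁U₀)^{u′}` both lie in the
axial gauge `S.IsAxial U₀ ·` are EQUAL.  [Balaban1985Variational] p. 281: «there exists exactly one gauge transformation u satisfying \overline{R₀u}ʲ
= 1 on Λ_j … These gauge transformations define a mapping of the space (18) into a space of gauge field configurations U₁U₀ … The above mapping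
is one-to-one»; the algebra is [Balaban1985Averaging] pp. 30–31: under the axial gauge conditions (67) for `U′ = U₁^u`, «(R̄₀uʲ)(x_j) =
u(x_j)\overline{R_{0,x_j}U₁}^{(j)}, x_j ∈ Ω^{(j)}, (84)», so the restriction «(R̄₀uᵏ)(y) = 1, y ∈ Ω^{(k)} (81)» gives «u(y) = (\overline{R_{0,y}U₁}^{(k)})⁻¹
(87)» and «Thus the gauge transformation is uniquely determined by all the conditions and is given by the formulas (77) for j = k − 1 and by (87)»
(p. 31).  THIS FILE proves that law for PRINT'S presentation at the Setup-torus objects — `IsAxial` := `B8Thm2SetupTorus.InAxT` ((1.19) = (67), the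
ITERATED axial gauge with the averages `Ūⁿ`, `n < k`, read on the periodic pullback), `Restricted` := `B8Thm2SetupTorus.Restr129T` ((1.29) = (79)–(81)
of [Balaban1985Averaging], the `k`-th order averaging of gauge transformations relative to `U₀`, read on the pullback) — for `U(N)` and, through
`toUField` ∕ `toUGauge`, for the `SU(2)` configurations of the T³ carrier `Site (F.P K) 0`; PURE ALGEBRA (no smallness, no unitarity used), uniform in
`k = K − n` and in the volume.  The ℤᵈ core is the tree's `B7Eq84Concrete.gaugeFixing_unique` (cell `lit-balaban`, [Balaban1985Averaging] Sect. C);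
the dictionaries are `B8Eq131Derivation.ax119_iff_ax67` ((1.19) ⟺ (67)), `B8Eq178Averages.restr129_iff_uavg` ((1.29) ⟺ (81) in `uavg`),
`B7Eq92Concrete.mgauge_mul` ((1.17) = (55)), `B8Thm2SetupTorus.cfgPull_mul` ∕ `pull_gaugeActT_eq` ∕ `gaugePull_injective` (periodic pullback).

LOCATED (for the owner's v8 re-cut of V3, count-neutral).  (a) The averaged gauge transformations (78)–(80) of [Balaban1985Averaging] AT THE T³ CARRIER
are `B8Thm2SetupTorus.Restr129T (F.P K) (K − n) (toUField U₀) (toUGauge _ 2 u)` — the B8 typer lane's letters of record (the same letters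
`B8Thm2SetupTorus.Thm2SetupSUAt` concludes with); no third encoding is filed here.  (b) Print pairs (81) with the ITERATED axial gauge (67) = (1.19)
(`InAxT`), NOT with the complete comb gauge of gen 7's `Prop7AxialGauge` (one `k`-comb per site): (84) telescopes only through the level-by-level
conditions (76); with the comb gauge the average (80) of `u` is a genuinely nonlinear function of `u` at the centre and (81) does not pin it — so a
presentation `S₀` that takes `Restricted := Restr129T` must take `IsAxial := InAxT` for the chart to be one-to-one (this file), and for [Balaban1985RegularSpaces]
Thm 2 (`Thm2SetupSUAt`, hypothesis `InAxT`) to apply.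

WHAT IS PROVED (sorry-free, no definition; `Site` below = torus sites of `Setup`, `LSite` = `ℤᵈ` sites).
§1 ℤᵈ: `exists_under` (every site lies `m` levels under some site), `axialGauge_of_inAx_torusLam` (`InAx L k (torusLam k) U₀ ((U₁^u)U₀)` ⟹ (67)
   `B7Eq84Concrete.AxialGauge L U₀ U₁ u k` at ALL blocks), `uavg_top_eq_one_of_restr129` ((1.29) on `Λ_k = T^{(k)}` ⟹ (81)),
   **`eq_of_inAx_restr129`** (two gauge transformations with (1.19) for `(U₁^u)U₀`, `(U₁^{u′})U₀` and (1.29) are equal — [Balaban1985Averaging] p. 31).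
§2 Setup torus, `U(N)`: `unitsField_gaugeActT`, `cfgPull_gaugeActT` (the pullback of `V^u` is `(V♯)^{u♯}`), `cfgPull_gaugeActT_mul` (the pullback of
   `(U₁U₀)^u` is `(U₁♯)^{u♯}·U₀♯` in the moving frame (55) ∕ (1.17)), **`eq_of_inAxT_restr129T`** (`u = u′`).
§3 `SU(N)` natively and the T³ carrier: `toUField_gaugeAct`, **`eq_of_inAxT_restr129T_su`**, and **`inj16_print`** — print's injectivity law in
   exactly the binder shape of `Prop7ChartInjectivity.prop7From14At_of_props_inj`'s hypothesis `hinj`, for every presentation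
   `S : T3SectALandauChart.Resid F n K` whose `IsAxial`, `Restricted` are (equivalent to) the `InAxT` ∕ `Restr129T` readings.

HONEST SCOPE.  Injectivity only (uniqueness of `u` GIVEN `U₁`); the EXISTENCE of the chart ([Balaban1985RegularSpaces] Thm 2 = `Thm2SetupSUAt`, V3-A)
and the existence of the (1.19)-representative inside the group (4) for `InAxT` (print p. 79; tree ℤᵈ twin `B8Eq119TwistedAxial.twistedFix_global`
in the small-field regime) are NOT proved here.  The regularity hypotheses `∈ regFibrePr` of the law are not used (print's uniqueness is algebraic).
Count-neutral helper toward stmt-QuantumFields-19200 (`--supports`), not a proof of the stub.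

References: T. Bałaban, CMP 102 (1985) 277–309 [Balaban1985Variational] ((16)–(18) p.280, Prop. 2 and «one-to-one» p.281); CMP 99 (1985) 75–102
[Balaban1985RegularSpaces] ((1.14) p.78, (1.17)–(1.20) pp.78–79, (1.29) p.81, Thm 2 p.83); CMP 98 (1985) 17–51 [Balaban1985Averaging] ((55)–(58) p.27,
(64)–(69) p.29, (76)–(81) p.30, (84)–(87) pp.30–31).
-/

noncomputable section

namespace Summit.QuantumFields.YangMills.Theorems.Prop7ChartInjectivityPrint

open Literature.MathematicalPhysics.QuantumFieldTheory.Balaban1983to89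
open B7Prop1Explicit renaming Site → LSite
open B7Prop1Explicit (treeWord boxVec)
open B7Prop2Explicit (avgIter)
open B7Eq92Concrete (mgauge mgauge_mul tHol tildIter)
open B7Eq84Concrete (AxialGauge uavg gaugeFixing_unique fl_decomp brem)
open B8Ineq130 (fl)
open B8Ineq132 (Under)
open B8Eq119TwistedAxial (InAx Restr129)
open B8Eq131Derivation (under_zero_iff under_one_block under_succ_of_under_block ax119_iff_ax67)
open B8Eq178Averages (restr129_iff_uavg)
open B8Thm4TorusAt (torusLam mem_torusLam_iff)
open B10Eq27TorusAxialLog (pull pull_apply gaugeActT gaugeActT_apply gaugeActT_eq_gaugeAct unitsField val_unitsField toUField suIncl)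
open B8Thm2SetupTorus (pullGauge cfgPull gaugePull cfgPull_mul pull_gaugeActT_eq gaugePull_injective InAxT Restr129T toUGauge toUGauge_injective
  toUField_mul)

/-! ## §1 On `ℤᵈ`: (1.19) on `Λ_k = T^{(k)}` + (1.29) determine the gauge transformation ([Balaban1985Averaging] p. 31) -/

section Zd

variable {d : ℕ}

/-- Every site of the fine lattice lies `m` levels under some site of the `m`-fold coarse lattice (`z ∈ Bᵐ(x)` for `x` the `m`-fold block of `z`;
Euclidean division `B8Ineq130.fl` iterated, `L ≥ 1`). [cite: Balaban1985RegularSpaces, p.79 («x₀ ∈ Bʲ(x_j)»)] -/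
theorem exists_under {L : ℕ} (hL : 1 ≤ L) : ∀ (m : ℕ) (z : LSite d), ∃ x : LSite d, Under L m x z
  | 0, z => ⟨z, (under_zero_iff L z z).2 rfl⟩
  | m + 1, z => by
    obtain ⟨x, hx⟩ := exists_under hL m z
    refine ⟨fl L x, under_succ_of_under_block ?_ hx⟩
    have h := under_one_block L (fl L x) (brem L hL x)
    rwa [fl_decomp hL x] at h

variable {𝔸 : Type*} [NormedRing 𝔸] [NormedAlgebra ℂ 𝔸] [CompleteSpace 𝔸]

/-- **(1.19) ON `Λ_k = T^{(k)}` IS (67) AT EVERY BLOCK**: if the full field `(U₁^u)U₀` (moving frame (55) ∕ (1.17)) lies in `Ax_k(𝔅_k, U₀)` in the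
sense of `B8Eq119TwistedAxial.InAx L k (torusLam k)` (the towers under ALL level-`k` sites), then `U′ = U₁^u` satisfies the block axial gauge conditions
(64) ∕ (66) ∕ (67) of [Balaban1985Averaging] at every level `j < k` and every block (`B7Eq84Concrete.AxialGauge`) — every block lies under some
level-`k` site (`exists_under`), and (1.19) ⟺ (67) blockwise (`B8Eq131Derivation.ax119_iff_ax67`).
[cite: Balaban1985RegularSpaces, (1.19) p.79; Balaban1985Averaging, (67) p.29] -/
theorem axialGauge_of_inAx_torusLam {L : ℕ} (hL : 1 ≤ L) {k : ℕ} {U₀ U₁ : LSite d → Fin d → 𝔸ˣ} {u : LSite d → 𝔸ˣ}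
    (hAx : InAx L k (torusLam k) U₀ (mgauge U₀ u U₁ * U₀)) : AxialGauge L U₀ U₁ u k := by
  intro j hj z r
  obtain ⟨x, hx⟩ := exists_under hL (k - (j + 1)) z
  have h := hAx k (by omega) le_rfl x ((mem_torusLam_iff k k x).2 rfl) j hj z hx r
  exact (ax119_iff_ax67 L U₀ (mgauge U₀ u U₁) j z r).1 h

/-- **(1.29) ON `Λ_k = T^{(k)}` IS (81)**: `Restr129 L k (torusLam k) U₀ u` gives `(\overline{R₀u})ᵏ(y) = uavg L U₀ u k y = 1` at every level-`k`
site (`B8Eq178Averages.restr129_iff_uavg`). [cite: Balaban1985RegularSpaces, (1.29) p.81; Balaban1985Averaging, (81) p.30] -/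
theorem uavg_top_eq_one_of_restr129 {L k : ℕ} {U₀ : LSite d → Fin d → 𝔸ˣ} {u : LSite d → 𝔸ˣ}
    (h : Restr129 L k (torusLam k) U₀ u) (y : LSite d) : uavg L U₀ u k y = 1 :=
  (restr129_iff_uavg L k _ U₀ u).1 h k le_rfl y ((mem_torusLam_iff k k y).2 rfl)

/-- **[Balaban1985Averaging] p. 31 «THE GAUGE TRANSFORMATION IS UNIQUELY DETERMINED BY ALL THE CONDITIONS» IN THE LETTERS OF [Balaban1985RegularSpaces]
(1.19) ∕ (1.29) on `ℤᵈ`**: two gauge transformations `u, u′` such that `(U₁^u)U₀` and `(U₁^{u′})U₀` are both in `Ax_k(T^{(k)}, U₀)` ((1.19), `InAx … (torusLam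
k)`) and both satisfy (1.29) on `T^{(k)}` are EQUAL (`B7Eq84Concrete.gaugeFixing_unique`: (87) pins `u` on `Ω^{(k)}`, (76) pins it block by block below).
Pure algebra, `L ≥ 1`. [cite: Balaban1985Averaging, (86)–(87) p.31, (76)–(77) pp.29–30; Balaban1985RegularSpaces, (1.19) p.79, (1.29) p.81] -/
theorem eq_of_inAx_restr129 {L : ℕ} (hL : 1 ≤ L) {k : ℕ} {U₀ U₁ : LSite d → Fin d → 𝔸ˣ} {u u' : LSite d → 𝔸ˣ}
    (hAx : InAx L k (torusLam k) U₀ (mgauge U₀ u U₁ * U₀)) (h129 : Restr129 L k (torusLam k) U₀ u)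
    (hAx' : InAx L k (torusLam k) U₀ (mgauge U₀ u' U₁ * U₀)) (h129' : Restr129 L k (torusLam k) U₀ u') : u = u' :=
  gaugeFixing_unique L hL U₀ U₁ k (axialGauge_of_inAx_torusLam hL hAx) (uavg_top_eq_one_of_restr129 h129)
    (axialGauge_of_inAx_torusLam hL hAx') (uavg_top_eq_one_of_restr129 h129')

end Zd

/-! ## §2 At the Setup-torus objects, `U(N)`: the pullback dictionary for the gauge action and the injectivity -/

section Torus

open scoped Matrix.Norms.L2Operator

variable {P : Params} {N : ℕ}

/-- The gauge action read in the units of `M_N(ℂ)`: `unitsField (V^u) = (unitsField V)^{toUnits ∘ u}` (`Unitary.toUnits` is multiplicative).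
[cite: Balaban1985Averaging, (8) p.19, (19) p.21] -/
theorem unitsField_gaugeActT (u : GaugeTransf P 0 (Matrix.unitaryGroup (Fin N) ℂ)) (V : GaugeField P 0 (Matrix.unitaryGroup (Fin N) ℂ)) :
    unitsField (gaugeActT u V) = gaugeActT (fun x => Unitary.toUnits (u x)) (unitsField V) := by
  funext b
  simp only [unitsField, gaugeActT_apply, map_mul, map_inv]

/-- **THE PULLBACK OF `V^u` IS `(V♯)^{u♯}`** ([Balaban1985Averaging] (8) read on the periodic `ℤᵈ` pullback from the origin: `B8Thm2SetupTorus.cfgPull`,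
`gaugePull`, `B10Eq27TorusAxialLog.pull_gaugeActT`). [cite: Balaban1985Averaging, (8) p.19; Balaban1985RegularSpaces, (1.3) p.77] -/
theorem cfgPull_gaugeActT (u : GaugeTransf P 0 (Matrix.unitaryGroup (Fin N) ℂ)) (V : GaugeField P 0 (Matrix.unitaryGroup (Fin N) ℂ)) :
    cfgPull P (gaugeActT u V) = B7Prop1Explicit.gaugeAct (gaugePull P u) (cfgPull P V) := by
  unfold cfgPull gaugePull
  rw [unitsField_gaugeActT, pull_gaugeActT_eq]

/-- **THE PULLBACK OF `(U₁U₀)^u` IS `(U₁♯)^{u♯}·U₀♯` WITH `U₁^u` IN THE MOVING FRAME (55) ∕ (1.17)** (`B7Eq92Concrete.mgauge_mul`: `U₁^u·U₀ = (U₁U₀)^u`).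
[cite: Balaban1985RegularSpaces, (1.16)–(1.17) p.78; Balaban1985Averaging, (55) p.27] -/
theorem cfgPull_gaugeActT_mul (u : GaugeTransf P 0 (Matrix.unitaryGroup (Fin N) ℂ)) (U₀ U₁ : GaugeField P 0 (Matrix.unitaryGroup (Fin N) ℂ)) :
    cfgPull P (gaugeActT u (fun b => U₁ b * U₀ b)) = mgauge (cfgPull P U₀) (gaugePull P u) (cfgPull P U₁) * cfgPull P U₀ := by
  rw [cfgPull_gaugeActT, cfgPull_mul, mgauge_mul]

/-- **PRINT'S INJECTIVITY AT THE SETUP-TORUS OBJECTS, `U(N)`** ([Balaban1985Variational] p. 281 «The above mapping is one-to-one»): if `u, u′` satisfy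
(1.29) relative to `U₀` (`Restr129T`) and both `(U₁U₀)^u`, `(U₁U₀)^{u′}` lie in `Ax_k(T^{(k)}, U₀)` (`InAxT`), then `u = u′` (the `ℤᵈ` statement on the
pullbacks, then `gaugePull_injective`). [cite: Balaban1985Variational, p.281 («The above mapping is one-to-one»); Balaban1985Averaging, (87) p.31] -/
theorem eq_of_inAxT_restr129T (k : ℕ) (U₀ U₁ : GaugeField P 0 (Matrix.unitaryGroup (Fin N) ℂ))
    {u u' : GaugeTransf P 0 (Matrix.unitaryGroup (Fin N) ℂ)}
    (hu : Restr129T P k U₀ u) (hu' : Restr129T P k U₀ u')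
    (hAx : InAxT P k U₀ (gaugeActT u (fun b => U₁ b * U₀ b))) (hAx' : InAxT P k U₀ (gaugeActT u' (fun b => U₁ b * U₀ b))) : u = u' := by
  have hL : 1 ≤ P.L := P.hL.2.le
  unfold InAxT at hAx hAx'
  rw [cfgPull_gaugeActT_mul] at hAx hAx'
  exact gaugePull_injective (eq_of_inAx_restr129 hL hAx hu hAx' hu')

end Torus

/-! ## §3 `SU(N)` natively, and the law at the T³ carrier in the binder shape of the corrected knit -/

section SU

open scoped Matrix.Norms.L2Operator

variable {P : Params} {N : ℕ} [NeZero N]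

/-- The `SU(N)` gauge action read in `U(N)`: `toUField (W^u) = (toUField W)^{toUGauge u}` (the inclusion `suIncl` is multiplicative).
[cite: Balaban1985Averaging, (8) p.19, (19) p.21] -/
theorem toUField_gaugeAct (u : GaugeTransf P 0 (Matrix.specialUnitaryGroup (Fin N) ℂ)) (W : GaugeField P 0 (Matrix.specialUnitaryGroup (Fin N) ℂ)) :
    toUField (GaugeField.gaugeAct u W) = gaugeActT (toUGauge P N u) (toUField W) := by
  funext b
  rw [← gaugeActT_eq_gaugeAct]
  simp only [toUField, gaugeActT_apply, B8Thm2SetupTorus.toUGauge_apply, map_mul, map_inv]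

/-- **PRINT'S INJECTIVITY AT THE SETUP-TORUS OBJECTS, `SU(N)` NATIVELY** (every letter read in `U(N)` through `toUField` ∕ `toUGauge`, the reading of
`B8Thm2SetupTorus.Thm2SetupSUAt`): (1.29) for `u, u′` relative to `U₀` and (1.19) for `(U₁U₀)^u`, `(U₁U₀)^{u′}` give `u = u′`.
[cite: Balaban1985Variational, p.281 («The above mapping is one-to-one»); Balaban1985Averaging, (87) p.31] -/
theorem eq_of_inAxT_restr129T_su (k : ℕ) (U₀ U₁ : GaugeField P 0 (Matrix.specialUnitaryGroup (Fin N) ℂ))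
    {u u' : GaugeTransf P 0 (Matrix.specialUnitaryGroup (Fin N) ℂ)}
    (hu : Restr129T P k (toUField U₀) (toUGauge P N u)) (hu' : Restr129T P k (toUField U₀) (toUGauge P N u'))
    (hAx : InAxT P k (toUField U₀) (toUField (GaugeField.gaugeAct u (fun b => U₁ b * U₀ b))))
    (hAx' : InAxT P k (toUField U₀) (toUField (GaugeField.gaugeAct u' (fun b => U₁ b * U₀ b)))) : u = u' := by
  rw [toUField_gaugeAct, toUField_mul] at hAx hAx'
  exact toUGauge_injective (eq_of_inAxT_restr129T k (toUField U₀) (toUField U₁) hu hu' hAx hAx')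

end SU

section T3

open scoped Matrix.Norms.L2Operator
open Literature.MathematicalPhysics.QuantumFieldTheory.Balaban1983to89.T3ContinuumYM3Torus
open Literature.MathematicalPhysics.QuantumFieldTheory.Balaban1983to89.T3PrintedRegularMinimiser (regFibrePr)
open T3SectALandauChart (Resid emb15)

variable (F : T3Family) {n K : ℕ} (h : n ≤ K)

/-- **PRINT'S INJECTIVITY LAW AT THE T³ CARRIER, IN THE BINDER SHAPE OF THE CORRECTED KNIT** (the hypothesis `hinj` of
`Summit…Prop7ChartInjectivity.prop7From14At_of_props_inj`, member by member): for every presentation `S : T3SectALandauChart.Resid F n K` whose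
`IsAxial U₀ U` is (implied by … implies) the (1.19)-reading `InAxT (F.P K) (K − n) (toUField U₀) (toUField U)` and whose `Restricted U₀ u` implies the
(1.29)-reading `Restr129T (F.P K) (K − n) (toUField U₀) (toUGauge _ 2 u)` — PRINT'S presentation of [Balaban1985Variational] Sect. A ∕
[Balaban1985RegularSpaces] Thm 2 — two restricted gauge transformations whose images of `U₁U₀` both lie in (18) are equal.  The regularity clauses
`∈ regFibrePr` are not used. [cite: Balaban1985Variational, p.281 («The above mapping is one-to-one»), (16)–(18) p.280; Balaban1985Averaging, (87) p.31] -/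
theorem inj16_print (S : Resid F n K)
    (hSax : ∀ U₀ U : GaugeField (F.P K) 0 (Matrix.specialUnitaryGroup (Fin 2) ℂ),
      S.IsAxial U₀ U → InAxT (F.P K) (K - n) (toUField U₀) (toUField U))
    (hSre : ∀ (U₀ : GaugeField (F.P K) 0 (Matrix.specialUnitaryGroup (Fin 2) ℂ)) (u : GaugeTransf (F.P K) 0 (Matrix.specialUnitaryGroup (Fin 2) ℂ)),
      S.Restricted U₀ u → Restr129T (F.P K) (K - n) (toUField U₀) (toUGauge (F.P K) 2 u))
    (ε₀ : ℝ) (V : GaugeField (F.P n) 0 (Matrix.specialUnitaryGroup (Fin 2) ℂ))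
    (U₀ U₁ : GaugeField (F.P K) 0 (Matrix.specialUnitaryGroup (Fin 2) ℂ)) (u u' : GaugeTransf (F.P K) 0 (Matrix.specialUnitaryGroup (Fin 2) ℂ))
    (hu : S.Restricted U₀ u) (hu' : S.Restricted U₀ u')
    (_h6 : GaugeField.gaugeAct u (emb15 U₀ U₁) ∈ regFibrePr F n K h ε₀ V) (hax : S.IsAxial U₀ (GaugeField.gaugeAct u (emb15 U₀ U₁)))
    (_h6' : GaugeField.gaugeAct u' (emb15 U₀ U₁) ∈ regFibrePr F n K h ε₀ V) (hax' : S.IsAxial U₀ (GaugeField.gaugeAct u' (emb15 U₀ U₁))) :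
    u = u' :=
  eq_of_inAxT_restr129T_su (K - n) U₀ U₁ (hSre U₀ u hu) (hSre U₀ u' hu') (hSax _ _ hax) (hSax _ _ hax')

end T3

end Summit.QuantumFields.YangMills.Theorems.Prop7ChartInjectivityPrint

end
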